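/-
COR-CM (cell pub-hodgecm2, stage 2 of the Hodge ladder) — Δ2 bridge, (c)+(d) closure at ι₁ after the coordinator's ruling «WORLD = C»
(pub-hodgecm2/INBOX 2026-08-23, item (4)), ι₁∕Id CHAIN row I2 (ASSEMBLER d2bridge-plan g3, TABLE v1.2): the Hecke translates on the
§4.2 carrier over the UNTWISTED Prop-C.5 datum `Model.honestP5IdOf h` (`HComp/HonestP5Id.lean`, `HComp/Sec42DataIdOf.lean`).
Seat prover-pub-hodgecm2-rekey-l0-instlevel-b-g0-0 (pen), «b» prover-pub-hodgecm2-rekey-l0-instlevel-a.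
DEFINITIONS (by formula) + `rfl`∕`HEq` bookkeeping; the named facts `h : exists_recordSystem` and `hU7 : heckeTranslate_definedOver` are
explicit per-declaration binders exactly as in `HComp/HeckeTranslatesOfRecord.lean` ∕ `HComp/HeckeTranslatesOfSec42DataOf.lean`;
nothing asserted; nothing in the tree edited or restated.  FRAMING: HC_CM is NOT proved; «Δ2 BRIDGE CLOSED» is NOT claimed.
-/
import Summits.HodgeConjecture.CorCM.B01.Transposition.HComp.Sec42DataIdOf
import Summits.HodgeConjecture.CorCM.B01.Transposition.HComp.HeckeTranslatesOfRecord
import HarnessLib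

/-!
# TEAM hComp, ι₁∕Id chain row I2: Hecke translates on the UNTWISTED §4.2 carrier `Model.sec42DataIdOf h iso`

`HComp/HeckeTranslatesOfRecord.lean` (hcomp-shimura) chooses the Hecke translates `T_g : M_K ⟶ M_{K'}` of the record system from the
named fact `hU7` ([Milne2005ShimuraVarieties] Thm. 13.6) — `recordHeckeTranslate`, `recordFunctorHeckeTranslate` with the three laws
`_one ∕ _mul ∕ _self` — and carries them to the TWISTED system `Sh(𝕍)_K = M_K ⊗_{F,c} F` by `(baseChangeHom (cmConjRingHom F)).map`
(`heckeTranslatesOf`, `sec42HeckeTranslatesOf`); `HComp/HeckeTranslatesOfSec42DataOf.lean` transports them to the total carrier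
`sec42DataOf h iso` (`heckeTranslatesFamilyOf`).  This file is the twin over the UNTWISTED datum of row I0∕I1
(`honestSystemIdOf h V Φ`, `Sh(𝕍)_K = X_K = M_K` ON THE NOSE, `sec42DataIdOfFourLe` ∕ `sec42DataIdOf`): every step is the source's with
the outer base change along `c` DROPPED —

* §1 `heckeTranslatesIdOf hU7 h V Φ h4 : (honestSystemIdOf h V Φ).HeckeTranslates` — `tr g K K' hK := recordFunctorHeckeTranslate …`
  itself; the laws ARE `recordFunctorHeckeTranslate_one ∕ _mul ∕ _self`;
* §2 `sec42HeckeTranslatesIdOf hU7 h V Φ h4 iso alb` — on `Sec42Data.ofAlbanese … (honestSystemIdOf h V Φ) … (compactifiedIdOf h V Φ h4) alb`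
  for EVERY choice `alb` of Albanese data (`HeckeTranslates.ofProjective`, Compact Case);
* §3 `sec42DataIdOfFourLe_heckeTranslates` (§2 at I1's choice of `alb`, definitionally), its `_tr` (`= recordFunctorHeckeTranslate …` by
  `rfl` — no `baseChangeHom`), `sec42DataIdOf_heckeTranslates` (transport along `sec42DataIdOf_eq_of_four_le`, a `cast`) with `_heq`, and
  the Π-family `heckeTranslatesFamilyIdOf hU7 h iso : ∀ F ι₁ V Φ, 6 ≤ [F:ℚ] → (sec42DataIdOf h iso F ι₁ V Φ).HeckeTranslates` — the
  binder `T` of the Hecke-layer displays at `C := Model.sec42DataIdOf h iso` (row I3's `𝒯₁`).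

CONDITIONAL on `h`, `hU7` (cited facts, hypotheses of every declaration); definitions only; HC_CM is NOT proved.

References: [Liu2021] Y. Liu, arXiv:2102.11518, §4.2 l. 2060–2074, Def. 4.16 l. 2219, Prop. C.5 l. 4627–4633, App. C l. 4656;
[Milne2005ShimuraVarieties] J. S. Milne, *Introduction to Shimura varieties* (2005), Def. 12.10 (a) p. 115, Thm. 13.6 p. 118;
[Deligne1979ShimuraVarieties] 2.1.4, 2.2.5, Cor. 2.7.21.
-/

set_option autoImplicit false

noncomputable section

open CategoryTheory AlgebraicGeometry NumberField
open Literature.AlgebraicGeometry.Motives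
open Literature.AlgebraicGeometry.ShimuraVarieties.UnitaryCanonicalModel
open Literature.NumberTheory.Automorphic
open Literature.NumberTheory.Automorphic.Liu2021
open Literature.NumberTheory.Automorphic.Liu2021.AppendixC
open Summit.HodgeConjecture.CorCM.HComp

namespace Summit.HodgeConjecture.CorCM.Model

/-! ## §1  Hecke translates on the untwisted system `honestSystemIdOf h V Φ` (`Sh(𝕍)_K = M_K`) -/

/-- **Hecke translates on `Model.honestSystemIdOf h V Φ`** (`Sh(𝕍) := recordFunctorOf h V`, NO twist): the record's translates
`recordFunctorHeckeTranslate hU7 h V h4` themselves (`T_g : M_K ⟶ M_{K'}` for `g⁻¹Kg ⊆ K'`, [Milne2005ShimuraVarieties] Thm. 13.6 via `hU7`),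
with `T_1` = transition, `T_g ≫ T_{g'} = T_{gg'}`, `T_k = 𝟙 (k ∈ K)` the record's own laws.  For `4 ≤ [F:ℚ]`.  CONDITIONAL on `hU7`, `h`;
HC_CM is NOT proved. [cite: Liu2021, Prop. C.5 l. 4627–4633 and §4.2 l. 2074] [cite: Milne2005ShimuraVarieties, Def. 12.10 (a) p. 115 and Thm. 13.6 p. 118] -/
def heckeTranslatesIdOf
    (hU7 : heckeTranslate_definedOver) (h : exists_recordSystem) {F : CMField} {ι₁ : F →+* ℂ} (V : HermSpace3 F ι₁)
    (Φ : Literature.AlgebraicGeometry.Motives.CMType F) (h4 : 4 ≤ Module.finrank ℚ F) :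
    IncoherentShimuraSystem.HeckeTranslates (honestSystemIdOf h V Φ) where
  tr g K K' hK := recordFunctorHeckeTranslate hU7 h V h4 g K K' hK
  tr_one := fun {_ _} f => recordFunctorHeckeTranslate_one hU7 h V h4 f
  tr_mul := fun g g' {_ _ _} hK hK' => recordFunctorHeckeTranslate_mul hU7 h V h4 g g' hK hK'
  tr_self := fun {_ _} hk => recordFunctorHeckeTranslate_self hU7 h V h4 hk

/-- The translate of the untwisted system IS the record translate (by `rfl`; no base change). [cite: Liu2021, Prop. C.5 l. 4627–4633] -/
theorem heckeTranslatesIdOf_tr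
    (hU7 : heckeTranslate_definedOver) (h : exists_recordSystem) {F : CMField} {ι₁ : F →+* ℂ} (V : HermSpace3 F ι₁)
    (Φ : Literature.AlgebraicGeometry.Motives.CMType F) (h4 : 4 ≤ Module.finrank ℚ F) (g : ↥V.adelicFin)
    (K K' : C5.SmallLevel (honestSystemIdOf h V Φ).K₀) (hK : C5.HeckeLE g K K') :
    (heckeTranslatesIdOf hU7 h V Φ h4).tr g K K' hK = recordFunctorHeckeTranslate hU7 h V h4 g K K' hK := rfl

/-! ## §2  On the §4.2 datum over the untwisted system (Compact Case), for every choice of Albanese data -/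

/-- **Hecke translates on the §4.2 datum over the UNTWISTED system in the Compact Case** (`X_K = Sh(𝕍)_K = M_K`, `Model.compactifiedIdOf`)
for EVERY choice `alb` of Albanese data of the `M_K` (the shape of I1's `sec42DataIdOfFourLe`), from `h` ([Deligne1979ShimuraVarieties]
2.2.5 ∕ Cor. 2.7.21) and `hU7` ([Milne2005ShimuraVarieties] Thm. 13.6) — `HeckeTranslates.ofProjective` on §1.  HC_CM is NOT proved.
[cite: Liu2021, §4.2 l. 2060–2074, Def. 4.16 l. 2219, App. C l. 4656] [cite: Milne2005ShimuraVarieties, Thm. 13.6 p. 118] -/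
def sec42HeckeTranslatesIdOf
    (hU7 : heckeTranslate_definedOver) (h : exists_recordSystem) {F : CMField} {ι₁ : F →+* ℂ} (V : HermSpace3 F ι₁)
    (Φ : Literature.AlgebraicGeometry.Motives.CMType F) (h4 : 4 ≤ Module.finrank ℚ F) (iso : ℕ → Prop)
    (alb : ∀ K : C5.SmallLevel (honestSystemIdOf h V Φ).K₀, Albanese ((honestSystemIdOf h V Φ).Sh𝕍.obj K)) :
    (Sec42Data.ofAlbanese (isotropicAt := iso) (Nat.le_of_ble_eq_true rfl) (honestSystemIdOf h V Φ)
      (isProjectiveOver_honestSystemIdOf_Sh_iff h V Φ h4 iso) (compactifiedIdOf h V Φ h4) alb).HeckeTranslates :=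
  (heckeTranslatesIdOf hU7 h V Φ h4).ofProjective (Nat.le_of_ble_eq_true rfl)
    (isProjectiveOver_honestSystemIdOf_Sh_iff h V Φ h4 iso) (smooth_honestSystemIdOf_Sh h V Φ h4)
    (projective_honestSystemIdOf_Sh h V Φ h4) alb

/-- The same under the chain's face guard `6 ≤ [F:ℚ]`. [cite: Liu2021, §4.2 l. 2060–2074] -/
def sec42HeckeTranslatesIdOf_of_six_le
    (hU7 : heckeTranslate_definedOver) (h : exists_recordSystem) {F : CMField} {ι₁ : F →+* ℂ} (V : HermSpace3 F ι₁)
    (Φ : Literature.AlgebraicGeometry.Motives.CMType F) (h6 : 6 ≤ Module.finrank ℚ F) (iso : ℕ → Prop)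
    (alb : ∀ K : C5.SmallLevel (honestSystemIdOf h V Φ).K₀, Albanese ((honestSystemIdOf h V Φ).Sh𝕍.obj K)) :
    (Sec42Data.ofAlbanese (isotropicAt := iso) (Nat.le_of_ble_eq_true rfl) (honestSystemIdOf h V Φ)
      (isProjectiveOver_honestSystemIdOf_Sh_iff h V Φ (le_trans (by norm_num) h6) iso)
      (compactifiedIdOf h V Φ (le_trans (by norm_num) h6)) alb).HeckeTranslates :=
  sec42HeckeTranslatesIdOf hU7 h V Φ (le_trans (by norm_num) h6) iso alb

/-! ## §3  On I1's carriers: the explicit `sec42DataIdOfFourLe` and the total `sec42DataIdOf` -/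

section FourLe

/-- **Hecke translates on the explicit untwisted §4.2 carrier `sec42DataIdOfFourLe h V Φ h4 iso`** (`4 ≤ [F:ℚ]`, Compact Case): §2 at
I1's choice of Albanese data `A_K := Alb_{M_K}` (definitionally) — `T_g : M_K ⟶ M_{K'}` for `g⁻¹Kg ⊆ K'` the record's Hecke translate
itself, with the three laws THEOREMS over the record.  CONDITIONAL on `h`, `hU7`.
[cite: Liu2021, §4.2 l. 2070–2074 and App. C l. 4656] [cite: Milne2005ShimuraVarieties, Def. 12.10 (a) p. 115 and Thm. 13.6 p. 118] -/
def sec42DataIdOfFourLe_heckeTranslates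
    (hU7 : heckeTranslate_definedOver) (h : exists_recordSystem)
    {F : CMField} {ι₁ : F →+* ℂ} (V : HermSpace3 F ι₁) (Φ : Literature.AlgebraicGeometry.Motives.CMType F) (h4 : 4 ≤ Module.finrank ℚ F) (iso : ℕ → Prop) :
    (sec42DataIdOfFourLe h V Φ h4 iso).HeckeTranslates :=
  sec42HeckeTranslatesIdOf hU7 h V Φ h4 iso _

/-- Its translate IS the record translate — NO base change (by `rfl`). [cite: Liu2021, Prop. C.5 l. 4627–4633 and App. C l. 4656] -/
theorem sec42DataIdOfFourLe_heckeTranslates_tr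
    (hU7 : heckeTranslate_definedOver) (h : exists_recordSystem)
    {F : CMField} {ι₁ : F →+* ℂ} (V : HermSpace3 F ι₁) (Φ : Literature.AlgebraicGeometry.Motives.CMType F) (h4 : 4 ≤ Module.finrank ℚ F) (iso : ℕ → Prop) (g : ↥V.adelicFin)
    (K K' : C5.SmallLevel (honestSystemIdOf h V Φ).K₀) (hK : C5.HeckeLE g K K') :
    (sec42DataIdOfFourLe_heckeTranslates hU7 h V Φ h4 iso).tr g K K' hK = recordFunctorHeckeTranslate hU7 h V h4 g K K' hK := rfl

end FourLe

/-- **Hecke translates on the TOTAL untwisted carrier `sec42DataIdOf h iso F ι₁ V Φ` at `4 ≤ [F:ℚ]`**: the explicit ones, transported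
along `sec42DataIdOf_eq_of_four_le` (`dif_pos`).  CONDITIONAL on `h`, `hU7`.
[cite: Liu2021, §4.2 l. 2070–2074] [cite: Milne2005ShimuraVarieties, Thm. 13.6 p. 118] -/
def sec42DataIdOf_heckeTranslates
    (hU7 : heckeTranslate_definedOver) (h : exists_recordSystem)
    {F : CMField} {ι₁ : F →+* ℂ} (V : HermSpace3 F ι₁) (Φ : Literature.AlgebraicGeometry.Motives.CMType F)
    (iso : ∀ (F : CMField) (ι₁ : F →+* ℂ) (_ : HermSpace3 F ι₁) (_ : Literature.AlgebraicGeometry.Motives.CMType F), ℕ → Prop)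
    (h4 : 4 ≤ Module.finrank ℚ F) : (sec42DataIdOf h iso F ι₁ V Φ).HeckeTranslates :=
  cast (congrArg (fun C => Sec42Data.HeckeTranslates C) (sec42DataIdOf_eq_of_four_le h V Φ iso h4).symm)
    (sec42DataIdOfFourLe_heckeTranslates hU7 h V Φ h4 (iso F ι₁ V Φ))

/-- Transport bookkeeping: along `sec42DataIdOf_eq_of_four_le` the translates on the total carrier ARE the explicit ones (a `cast`
along `congrArg HeckeTranslates`; rewrite a goal with `sec42DataIdOf_eq_of_four_le` first, then use this). [cite: Liu2021, §4.2 l. 2070–2074] -/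
theorem sec42DataIdOf_heckeTranslates_heq
    (hU7 : heckeTranslate_definedOver) (h : exists_recordSystem)
    {F : CMField} {ι₁ : F →+* ℂ} (V : HermSpace3 F ι₁) (Φ : Literature.AlgebraicGeometry.Motives.CMType F)
    (iso : ∀ (F : CMField) (ι₁ : F →+* ℂ) (_ : HermSpace3 F ι₁) (_ : Literature.AlgebraicGeometry.Motives.CMType F), ℕ → Prop)
    (h4 : 4 ≤ Module.finrank ℚ F) :
    HEq (sec42DataIdOf_heckeTranslates hU7 h V Φ iso h4)
      (sec42DataIdOfFourLe_heckeTranslates hU7 h V Φ h4 (iso F ι₁ V Φ)) :=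
  cast_heq _ _

/-- **`heckeTranslatesFamilyIdOf hU7 h iso`** — the Hecke translates as the Π-family `∀ F ι₁ V Φ, 6 ≤ [F:ℚ] →
(sec42DataIdOf h iso F ι₁ V Φ).HeckeTranslates` over the UNTWISTED carrier: the binder `T` of the Hecke-layer displays at
`C := Model.sec42DataIdOf h iso` (`6 ≤ [F:ℚ]` ⇒ `4 ≤ [F:ℚ]`).  CONDITIONAL on `h`, `hU7`; instantiating `T` at this term is the
consumer's act (row I3's `𝒯₁`), not done here; HC_CM is NOT proved. [cite: Liu2021, §4.2 l. 2070–2074, Def. 4.16 l. 2219] [cite: Milne2005ShimuraVarieties, Thm. 13.6 p. 118] -/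
def heckeTranslatesFamilyIdOf (hU7 : heckeTranslate_definedOver) (h : exists_recordSystem)
    (iso : ∀ (F : CMField) (ι₁ : F →+* ℂ) (_ : HermSpace3 F ι₁) (_ : Literature.AlgebraicGeometry.Motives.CMType F), ℕ → Prop) :
    ∀ (F : CMField) (ι₁ : F →+* ℂ) (V : HermSpace3 F ι₁) (Φ : Literature.AlgebraicGeometry.Motives.CMType F),
      6 ≤ Module.finrank ℚ F → (sec42DataIdOf h iso F ι₁ V Φ).HeckeTranslates :=
  fun _ _ V Φ h6 => sec42DataIdOf_heckeTranslates hU7 h V Φ iso (le_trans (by norm_num) h6)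

/-- Under the face guard `6 ≤ [F:ℚ]`, the family's translate at `(F, ι₁, V, Φ)` is, along `sec42DataIdOf_eq_of_six_le`, the explicit one
(`HEq`; the `cast` of `sec42DataIdOf_heckeTranslates`). [cite: Liu2021, §4.2 l. 2070–2074] -/
theorem heckeTranslatesFamilyIdOf_heq (hU7 : heckeTranslate_definedOver) (h : exists_recordSystem)
    (iso : ∀ (F : CMField) (ι₁ : F →+* ℂ) (_ : HermSpace3 F ι₁) (_ : Literature.AlgebraicGeometry.Motives.CMType F), ℕ → Prop)
    {F : CMField} {ι₁ : F →+* ℂ} (V : HermSpace3 F ι₁) (Φ : Literature.AlgebraicGeometry.Motives.CMType F)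
    (h6 : 6 ≤ Module.finrank ℚ F) :
    HEq (heckeTranslatesFamilyIdOf hU7 h iso F ι₁ V Φ h6)
      (sec42DataIdOfFourLe_heckeTranslates hU7 h V Φ (le_trans (by norm_num) h6) (iso F ι₁ V Φ)) :=
  cast_heq _ _

end Summit.HodgeConjecture.CorCM.Model

end
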